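import Literature.AlgebraicTopology.Homotopy.FibrewiseWeakEquivalence
import Literature.AlgebraicTopology.Homotopy.FibrationOverContractibleBase
import Literature.AlgebraicTopology.SingularHomology.PuncturedCupSphere
import Literature.AlgebraicTopology.SingularHomology.SphereComplement
import Literature.AlgebraicTopology.SingularHomology.WeakEquivalenceHomology
import Literature.AlgebraicTopology.SingularHomology.HomDualComplex
import Literature.AlgebraicTopology.SingularHomology.CohomologyHomotopyInvariance
import Literature.AlgebraicTopology.SingularHomology.UniversalCoefficientsProofs
import HarnessLib

/-!
# The Wang sequence of a fibration over a sphere, with its derivation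

H. C. Wang, *The homology groups of the fibre bundles over a sphere*, Duke Math. J. 16 (1949);
G. W. Whitehead, *Elements of Homotopy Theory* (1978), Ch. VII §7 ("The Wang sequence",
Thm. 7.14 / Cor. 7.15: for a fibration `F → E → Sᵐ`, `m ≥ 2`, there is an exact sequence
`⋯ → Hᵠ(E) → Hᵠ(F) →θ H^{q-m+1}(F) → H^{q+1}(E) → ⋯` and `θ` is a derivation:
`θ(x ⌣ y) = θx ⌣ y + (-1)^{(m-1)|x|} x ⌣ θy`); A. Hatcher, *Spectral Sequences in Algebraic
Topology*, Ch. 1, Example 1.16 and the Wang-sequence remark; J.-P. Serre, *Homologie singulière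
des espaces fibrés* (1951), Ch. III §6 (suite exacte de Wang). Proved here for a fibration
`p : E → Sᵏ⁺²` (Hurewicz and Serre — both hold for pull-backs of path fibrations) with fibre
`F = p⁻¹(N)` over the north pole and coefficients in a commutative ring `R`:

* `Wang.Poles k` — the data: the point `v` (fibre `F = p⁻¹(v)`), a second point `w ≠ v` (the
  punctured spheres `Sᵏ⁺² ∖ {w}`, `Sᵏ⁺² ∖ {v}` cover the base) and an auxiliary point `x₀` of the
  band `Sᵏ⁺² ∖ {v, w}`, which is a cup-sphere of level `k + 1` (`Poles.isCupSphere_gen`, from the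
  tree's `exists_isCupSphere_punctured`);
* `Wang.T n : Hⁿ(F) →ₗ Hⁿ(F × band)` — **the clutching map on cohomology** (restriction from the
  piece over `Sᵏ⁺² ∖ {v}` to the band piece `p⁻¹(band) ≃ F × band`, trivialised from the OTHER
  side by the lifted contraction of `Sᵏ⁺² ∖ {w}` to `v`): MULTIPLICATIVE (`T_cupProduct`), split by
  the slice (`map_sliceAt_T`); by the cup-form Künneth decomposition of the tree (`IsCupSphere`)
  `T y = pr₁^* y + pr₂^* g ⌣ pr₁^*(D y)` in degrees `i + (k+1)` (`T_eq_sphereSplit`) and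
  `T y = pr₁^* y` below degree `k + 1` (`T_eq_map_fst_of_lt`), which DEFINES
  `Wang.D i : H^{i+(k+1)}(F) →ₗ Hⁱ(F)` — Wang's `θ`;
* **derivation property**, mixed form (`D_cupProduct_of_lt`): `D(y ⌣ z) = D y ⌣ z` for
  `deg z < k + 1` (from the multiplicativity of `T`; the form with both factors of degree `≥ k + 1`
  follows the same way from `T_cupProduct`, `T_eq_sphereSplit` and `cupProduct_gen_gen`, and is left
  to the applications);
* **exactness** (the Wang sequence `0 → coker D → H(E) → ker D → 0`): the restriction
  `ι^* : Hⁿ(E) → Hⁿ(F)` has image `ker D` in degrees `i + (k+1)` (`mem_range_iff_D_eq_zero`), is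
  injective in degrees `≤ k + 1` and bijective below `k + 1` (`map_fibIncl_injective`,
  `map_fibIncl_bijective_of_lt`); and `Wang.lam i : Hⁱ(F) →ₗ H^{i+k+2}(E)` has kernel
  `range (D i)` and image `ker ι^*` (`lam_eq_zero_iff`, `mem_range_lam_iff`).

Proof (Whitehead VII.7 / Serre III.6, organised as in the tree's `TwoPieceProductCohomology`):
`E = E₊ ∪ E₋` (pre-images of the two punctured spheres); the lifted contraction of the northern
cap (`IsHurewiczFibration.retractFibre`) retracts `E₊` onto `F` and, with the projection,
identifies the band piece with `F × Sᵏ⁺¹` up to weak equivalence (fibrewise comparison,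
`IsSerreFibration.isWeakHomotopyEquiv_of_fibrewise`; weak equivalences induce cohomology
isomorphisms, `isIso_singularCohomology_map_of_isWeakHomotopyEquiv`); the long exact sequence of
the pair `(E, E₋)`, excised to `(E₊, band)`, then reads off the statements, the connecting map
being `λ ∘ D` with `λ : Hⁱ(F) ≅ H^{i+k+2}(E₊, band)`. Everything is proved; no named fact.
Universe: spaces and the ring in `Type` (the cup-sphere engine `IsCupSphere` puts the ring and the spaces in one universe; the spheres live in `Type`).

## References

* H. C. Wang, *The homology groups of the fibre bundles over a sphere*, Duke Math. J. 16 (1949),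
  33–38. [Wang1949]
* G. W. Whitehead, *Elements of Homotopy Theory*, GTM 61, Springer (1978), Ch. VII §7,
  Thm. 7.14, Cor. 7.15. [Whitehead1978]
* J.-P. Serre, *Homologie singulière des espaces fibrés. Applications*, Ann. of Math. 54 (1951),
  Ch. III §6. [Serre1951]
* A. Hatcher, *Algebraic Topology*, CUP (2002), §3.1 pp. 200–203, §4.2 Prop. 4.61, Cor. 4.63.
  [HatcherAT2002]
-/

noncomputable section

open Set Function Metric unitInterval CategoryTheory
open scoped Topology unitInterval
open Literature.AlgebraicTopology.SingularHomology

namespace Literature.AlgebraicTopology.Homotopy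

/-- Local notation: `𝔼 n` is the model Euclidean space `EuclideanSpace ℝ (Fin n)`. -/
local notation "𝔼 " n:arg => EuclideanSpace ℝ (Fin n)

/-- Local notation: `𝕊 n` is the unit sphere in `EuclideanSpace ℝ (Fin (n + 1))`. -/
local notation "𝕊 " n:arg => (Metric.sphere (0 : EuclideanSpace ℝ (Fin (n + 1))) 1)

universe u v

/-! ### Weak equivalences induce isomorphisms on cohomology with coefficients in any ring -/

/-- The singular chain modules are projective objects of `ModuleCat R` (they are free).
[cite: HatcherAT2002, §2.1] -/
theorem projective_singularChainComplex_X (R : Type v) [CommRing R] (X : Type u) [TopologicalSpace X]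
    (n : ℕ) : Projective ((singularChainComplex R R X).X n) := by
  haveI := free_singularChainComplex_X R (X := X) n
  haveI : Module.Projective R ((singularChainComplex R R X).X n) := Module.Projective.of_free
  exact ModuleCat.projective_of_categoryTheory_projective ((singularChainComplex R R X).X n)

/-- **A weak homotopy equivalence induces isomorphisms `Hⁿ(Y; R) ≅ Hⁿ(X; R)`** for every
commutative ring `R` (Spanier 7.6.25 in homology; the chain map is then a quasi-isomorphism of
complexes of free modules, whose `Hom`-dual is a quasi-isomorphism, Hatcher §3.1 p. 201).
[cite: Spanier1981, Ch. 7, Sec. 6, Thm. 25] [cite: HatcherAT2002, §3.1 p. 201] -/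
theorem isIso_singularCohomology_map_of_isWeakHomotopyEquiv (R : Type v) [CommRing R] {X Y : Type u}
    [TopologicalSpace X] [TopologicalSpace Y] (f : C(X, Y)) (hf : IsWeakHomotopyEquiv f) (n : ℕ) :
    IsIso (singularCohomology.map R R f n) := by
  haveI : ∀ i, IsIso (HomologicalComplex.homologyMap (singularChainComplex.map R R f) i) := fun i =>
    isIso_singularHomology_map_of_isWeakHomotopyEquiv R f hf i
  haveI : QuasiIso (singularChainComplex.map R R f) :=
    (quasiIso_iff _).2 fun i => (quasiIsoAt_iff_isIso_homologyMap _ i).2 inferInstance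
  haveI := projective_singularChainComplex_X R X
  haveI := projective_singularChainComplex_X R Y
  haveI hd := isIso_homologyMap_dualMap_of_quasiIso (N := ModuleCat.of R (ULift.{u} R))
    (singularChainComplex.map R R f) n
  -- work in `(down ℕ).symm`-complexes, where the `Hom`-dual lives
  have hcomp : HomologicalComplex.homologyMap (c := (ComplexShape.down ℕ).symm)
      (K := singularCochainComplex R R Y) (L := singularCochainComplex R R X) (singularCochainComplex.map R R f) n =
      HomologicalComplex.homologyMap (c := (ComplexShape.down ℕ).symm)
        (K := singularCochainComplex R R Y) (L := dualObj R (ModuleCat.of R (ULift.{u} R)) (singularChainComplex R R Y))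
        (singularCochainComplex.cochainIso R R Y).hom n ≫
      (HomologicalComplex.homologyMap (c := (ComplexShape.down ℕ).symm)
        (K := dualObj R (ModuleCat.of R (ULift.{u} R)) (singularChainComplex R R Y))
        (L := dualObj R (ModuleCat.of R (ULift.{u} R)) (singularChainComplex R R X))
        (dualMap R (ModuleCat.of R (ULift.{u} R)) (singularChainComplex.map R R f)) n ≫
      HomologicalComplex.homologyMap (c := (ComplexShape.down ℕ).symm)
        (K := dualObj R (ModuleCat.of R (ULift.{u} R)) (singularChainComplex R R X))
        (L := singularCochainComplex R R X) (singularCochainComplex.cochainIso R R X).inv n) := by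
    have a := congrArg (fun φ => HomologicalComplex.homologyMap (c := (ComplexShape.down ℕ).symm)
      (K := singularCochainComplex R R Y) (L := singularCochainComplex R R X) φ n) (singularCochainComplex.map_eq_conj_dualMap R R f)
    have b := HomologicalComplex.homologyMap_comp (c := (ComplexShape.down ℕ).symm)
      (K := singularCochainComplex R R Y) (L := dualObj R (ModuleCat.of R (ULift.{u} R)) (singularChainComplex R R Y))
      (M := singularCochainComplex R R X) (singularCochainComplex.cochainIso R R Y).hom
      (dualMap R (ModuleCat.of R (ULift.{u} R)) (singularChainComplex.map R R f) ≫ (singularCochainComplex.cochainIso R R X).inv) n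
    have c := HomologicalComplex.homologyMap_comp (c := (ComplexShape.down ℕ).symm)
      (K := dualObj R (ModuleCat.of R (ULift.{u} R)) (singularChainComplex R R Y))
      (L := dualObj R (ModuleCat.of R (ULift.{u} R)) (singularChainComplex R R X))
      (M := singularCochainComplex R R X) (dualMap R (ModuleCat.of R (ULift.{u} R)) (singularChainComplex.map R R f))
      (singularCochainComplex.cochainIso R R X).inv n
    exact a.trans (b.trans (by rw [c]))
  haveI : IsIso (HomologicalComplex.homologyMap (c := (ComplexShape.down ℕ).symm)
      (K := singularCochainComplex R R Y)
      (L := dualObj R (ModuleCat.of R (ULift.{u} R)) (singularChainComplex R R Y))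
      (singularCochainComplex.cochainIso R R Y).hom n) := by
    haveI : IsIso (C := HomologicalComplex (ModuleCat.{max u v} R) (ComplexShape.down ℕ).symm)
        (X := singularCochainComplex R R Y) (Y := dualObj R (ModuleCat.of R (ULift.{u} R)) (singularChainComplex R R Y))
        (singularCochainComplex.cochainIso R R Y).hom := (singularCochainComplex.cochainIso R R Y).isIso_hom
    infer_instance
  haveI : IsIso (HomologicalComplex.homologyMap (c := (ComplexShape.down ℕ).symm)
      (K := dualObj R (ModuleCat.of R (ULift.{u} R)) (singularChainComplex R R X))
      (L := singularCochainComplex R R X)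
      (singularCochainComplex.cochainIso R R X).inv n) := by
    haveI : IsIso (C := HomologicalComplex (ModuleCat.{max u v} R) (ComplexShape.down ℕ).symm)
        (X := dualObj R (ModuleCat.of R (ULift.{u} R)) (singularChainComplex R R X)) (Y := singularCochainComplex R R X)
        (singularCochainComplex.cochainIso R R X).inv := (singularCochainComplex.cochainIso R R X).isIso_inv
    infer_instance
  change IsIso (HomologicalComplex.homologyMap (c := (ComplexShape.down ℕ).symm)
    (K := singularCochainComplex R R Y) (L := singularCochainComplex R R X) (singularCochainComplex.map R R f) n)
  rw [hcomp]
  infer_instance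

/-- Bijectivity form. [cite: Spanier1981, Ch. 7, Sec. 6, Thm. 25] -/
theorem bijective_singularCohomology_map_of_isWeakHomotopyEquiv (R : Type v) [CommRing R] {X Y : Type u}
    [TopologicalSpace X] [TopologicalSpace Y] (f : C(X, Y)) (hf : IsWeakHomotopyEquiv f) (n : ℕ) :
    Bijective (singularCohomology.map R R f n) := by
  haveI := isIso_singularCohomology_map_of_isWeakHomotopyEquiv R f hf n
  exact (asIso (singularCohomology.map R R f n)).toLinearEquiv.bijective

/-! ### Contractions transported along homeomorphisms; the contraction of a punctured sphere -/

/-- Transport of a contraction fixing a point along a homeomorphism. [folklore] -/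
def ContractionAt.ofHomeomorph {B : Type u} {B' : Type v} [TopologicalSpace B] [TopologicalSpace B']
    {b₀' : B'} (c : ContractionAt B' b₀') (e : B ≃ₜ B') (b₀ : B) (hb : e b₀ = b₀') : ContractionAt B b₀ where
  H := (e.symm : C(B', B)).comp (c.H.comp ((ContinuousMap.id I).prodMap (e : C(B, B'))))
  map_zero b := by
    show e.symm (c.H (0, e b)) = b
    rw [c.map_zero, e.symm_apply_apply]
  map_one b := by
    show e.symm (c.H (1, e b)) = b₀
    rw [c.map_one, ← hb, e.symm_apply_apply]
  map_pt t := by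
    show e.symm (c.H (t, e b₀)) = b₀
    rw [hb, c.map_pt, ← hb, e.symm_apply_apply]

/-- A Euclidean space contracts to any of its points. [folklore] -/
def contractionAtEuclidean {m : ℕ} (x : 𝔼 m) : ContractionAt (𝔼 m) x :=
  (contractionAt_of_starConvex (starConvex_univ x) (mem_univ x)).ofHomeomorph
    (Homeomorph.Set.univ (𝔼 m)).symm x rfl

/-- **A punctured sphere `Sᵐ ∖ {w}` contracts to any of its points** (stereographic projection from
`w` and a straight-line contraction). [folklore] -/
def puncturedSphereContraction {m : ℕ} (w : 𝕊 m) (v : ↥({w}ᶜ : Set (𝕊 m))) :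
    ContractionAt ↥({w}ᶜ : Set (𝕊 m)) v :=
  (contractionAtEuclidean (SphereComplement.sphereMinusPointHomeomorph w v)).ofHomeomorph
    (SphereComplement.sphereMinusPointHomeomorph w) v rfl

/-! ### The setting: two punctures of the base and an auxiliary base point -/

namespace Wang

open SphereComplement

/-- **The data of the Wang sequence over `Sᵏ⁺²`**: the point `v` over which the fibre is taken, a
second point `w ≠ v` (the two punctured spheres `Sᵏ⁺² ∖ {w} ∋ v`, `Sᵏ⁺² ∖ {v} ∋ w` cover the
base), and an auxiliary point `x₀` of the band `Sᵏ⁺² ∖ {v, w}`. [cite: Whitehead1978, Ch. VII §7] -/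
structure Poles (k : ℕ) where
  /-- the point over which the fibre is taken -/
  v : 𝕊 (k + 2)
  /-- the opposite puncture -/
  w : 𝕊 (k + 2)
  /-- an auxiliary point of the band -/
  x₀ : 𝕊 (k + 2)
  v_ne_w : v ≠ w
  x₀_ne_v : x₀ ≠ v
  x₀_ne_w : x₀ ≠ w

variable (R : Type) [CommRing R] {E : Type} [TopologicalSpace E] {k : ℕ} (P : Poles k) {p : E → 𝕊 (k + 2)}

namespace Poles

/-- The cap `Sᵏ⁺² ∖ {w}` containing `v`. [folklore] -/
abbrev capV : Set (𝕊 (k + 2)) := {P.w}ᶜ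

/-- The cap `Sᵏ⁺² ∖ {v}` containing `w`. [folklore] -/
abbrev capW : Set (𝕊 (k + 2)) := {P.v}ᶜ

/-- **The band `Sᵏ⁺² ∖ {v, w}`.** [folklore] -/
abbrev bandSet : Set (𝕊 (k + 2)) := ({P.v, P.w} : Set (𝕊 (k + 2)))ᶜ

/-- `v ∈ capV`. [folklore] -/
theorem v_mem_capV : P.v ∈ P.capV := fun h => P.v_ne_w h

/-- `x₀ ∈ capV`. [folklore] -/
theorem x₀_mem_capV : P.x₀ ∈ P.capV := fun h => P.x₀_ne_w h

/-- `x₀ ∈ capW`. [folklore] -/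
theorem x₀_mem_capW : P.x₀ ∈ P.capW := fun h => P.x₀_ne_v h

/-- `x₀ ∈ band`. [folklore] -/
theorem x₀_mem_bandSet : P.x₀ ∈ P.bandSet := by
  simp only [mem_compl_iff, mem_insert_iff, mem_singleton_iff, not_or]
  exact ⟨P.x₀_ne_v, P.x₀_ne_w⟩

/-- A point of both caps lies in the band. [folklore] -/
theorem mem_bandSet {z : 𝕊 (k + 2)} (hV : z ∈ P.capV) (hW : z ∈ P.capW) : z ∈ P.bandSet := by
  simp only [mem_compl_iff, mem_insert_iff, mem_singleton_iff, not_or]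
  exact ⟨hW, hV⟩

/-- The caps cover. [folklore] -/
theorem capV_union_capW : P.capV ∪ P.capW = univ := by
  ext z
  simp only [mem_union, mem_compl_iff, mem_singleton_iff, mem_univ, iff_true]
  by_contra h
  push Not at h
  exact P.v_ne_w (h.2.symm.trans h.1)

/-- The caps are contractible (punctured spheres). [folklore] -/
instance contractibleSpace_capV : ContractibleSpace ↥P.capV := (sphereMinusPointHomeomorph P.w).contractibleSpace

/-- The caps are contractible (punctured spheres). [folklore] -/
instance contractibleSpace_capW : ContractibleSpace ↥P.capW := (sphereMinusPointHomeomorph P.v).contractibleSpace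

/-- **The band is a cup-sphere of level `k + 1`** (it is `ℝᵏ⁺² ∖ 0`, Künneth in cup form for
every space, `PuncturedCupSphere`). [cite: HatcherAT2002, §3.2 Thm. 3.16, Example 3.11] -/
theorem exists_isCupSphere_band : ∃ g : singularCohomology R R ↥P.bandSet (k + 1), IsCupSphere R ↥P.bandSet (k + 1) g := by
  obtain ⟨g, hg⟩ := exists_isCupSphere_punctured R (k + 1)
  exact ⟨_, hg.of_homeomorph (sphereMinusTwoPointsHomeomorph P.v P.w P.v_ne_w.symm)⟩

/-- A chosen cup-sphere generator `g ∈ Hᵏ⁺¹(band; R)`. [folklore] -/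
def gen : singularCohomology R R ↥P.bandSet (k + 1) := (P.exists_isCupSphere_band R).choose

/-- The chosen generator makes the band a cup-sphere. [cite: HatcherAT2002, §3.2 Thm. 3.16] -/
theorem isCupSphere_gen : IsCupSphere R ↥P.bandSet (k + 1) (P.gen R) := (P.exists_isCupSphere_band R).choose_spec

end Poles

/-! #### Pieces of the total space -/

section Pieces

variable (p)

/-- The piece `E₊ = p⁻¹(Sᵏ⁺² ∖ {w})` (containing the fibre over `v`) as a subset. [folklore] -/
abbrev plusSet : Set E := p ⁻¹' P.capV

/-- The piece `E₋ = p⁻¹(Sᵏ⁺² ∖ {v})` as a subset. [folklore] -/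
abbrev minusSet : Set E := p ⁻¹' P.capW

/-- **The fibre `F = p⁻¹(v)`.** [folklore] -/
abbrev Fib : Type := ↥(p ⁻¹' {P.v})

/-- The fibre `F₀ = p⁻¹(x₀)` over the auxiliary point. [folklore] -/
abbrev Fib0 : Type := ↥(p ⁻¹' {P.x₀})

/-- The projection of `E₊` to its cap. [folklore] -/
abbrev pPlus : ↥(plusSet P p) → ↥P.capV := P.capV.restrictPreimage p

/-- The band seen in the cap `capV`. [folklore] -/
abbrev bandN : Set ↥P.capV := Subtype.val ⁻¹' P.capW

/-- **The band piece** `p⁻¹(band) = E₊ ∩ E₋` as a subset of `E₊`. [folklore] -/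
abbrev bandPiece : Set ↥(plusSet P p) := pPlus P p ⁻¹' bandN P

/-- The inclusion `F ↪ E₊`. [folklore] -/
abbrev fibInclPlus : C(Fib P p, ↥(plusSet P p)) :=
  subsetInclusion (preimage_mono (singleton_subset_iff.2 P.v_mem_capV))

/-- **The inclusion `ι : F ↪ E`.** [folklore] -/
abbrev fibIncl : C(Fib P p, E) := subsetIncl _

/-- The inclusion `F₀ ↪ E₊`. [folklore] -/
abbrev fib0InclPlus : C(Fib0 P p, ↥(plusSet P p)) :=
  subsetInclusion (preimage_mono (singleton_subset_iff.2 P.x₀_mem_capV))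

/-- The inclusion `F₀ ↪ E₋`. [folklore] -/
abbrev fib0InclMinus : C(Fib0 P p, ↥(minusSet P p)) :=
  subsetInclusion (preimage_mono (singleton_subset_iff.2 P.x₀_mem_capW))

/-- The inclusion of the band piece into `E₋`. [folklore] -/
def bandToMinus : C(↥(bandPiece P p), ↥(minusSet P p)) where
  toFun e := ⟨e.1.1, e.2⟩
  continuous_toFun := (continuous_subtype_val.comp continuous_subtype_val).subtype_mk _

/-- The inclusion `F₀ ↪ band piece`. [folklore] -/
def fib0InclBand : C(Fib0 P p, ↥(bandPiece P p)) where
  toFun e := ⟨⟨e.1, mem_preimage.2 (mem_of_eq_of_mem (show p e.1 = P.x₀ from e.2) P.x₀_mem_capV)⟩,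
    show p e.1 ∈ P.capW from mem_of_eq_of_mem (show p e.1 = P.x₀ from e.2) P.x₀_mem_capW⟩
  continuous_toFun := (continuous_subtype_val.subtype_mk _).subtype_mk _

/-- A point of the band piece, seen in the band. [folklore] -/
def toBand (e : ↥(bandPiece P p)) : ↥P.bandSet := ⟨p e.1.1, P.mem_bandSet e.1.2 e.2⟩

/-- `toBand` is continuous. [folklore] -/
theorem continuous_toBand (hpc : Continuous p) : Continuous (toBand P p) :=
  (hpc.comp (continuous_subtype_val.comp continuous_subtype_val)).subtype_mk _

end Pieces

/-! #### The retraction of `E₊` onto the fibre -/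

section Retraction


/-- The restricted Hurewicz fibration `E₊ → capV`. [folklore] -/
theorem hpPlus (hp : IsHurewiczFibration.{0, 0, 0} p) : IsHurewiczFibration.{0, 0, 0} (pPlus P p) := hp.restrictPreimage _

/-- The fibre of `E₊ → capV` over `v` as a subset of `E₊`. [folklore] -/
abbrev fibPlusSet (p : E → 𝕊 (k + 2)) : Set ↥(plusSet P p) := pPlus P p ⁻¹' {(⟨P.v, P.v_mem_capV⟩ : ↥P.capV)}

/-- The fibre of `E₊ → capV` over `v`, identified with `F`. [folklore] -/
def fibPlusHomeomorph (p : E → 𝕊 (k + 2)) : ↥(fibPlusSet P p) ≃ₜ Fib P p where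
  toFun e := ⟨e.1.1, congrArg Subtype.val (show pPlus P p e.1 = ⟨P.v, P.v_mem_capV⟩ from e.2)⟩
  invFun f := ⟨⟨f.1, mem_preimage.2 (mem_of_eq_of_mem (show p f.1 = P.v from f.2) P.v_mem_capV)⟩,
    show pPlus P p _ = _ from Subtype.ext (show p f.1 = P.v from f.2)⟩
  left_inv _ := rfl
  right_inv _ := rfl
  continuous_toFun := (continuous_subtype_val.comp continuous_subtype_val).subtype_mk _
  continuous_invFun := (continuous_subtype_val.subtype_mk _).subtype_mk _

/-- **The retraction `R₊ : E₊ → F`** (end of the lifted contraction of the cap to `v`).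
[cite: HatcherAT2002, §4.2 Prop. 4.61, Cor. 4.63] -/
def retr (hp : IsHurewiczFibration.{0, 0, 0} p) : C(↥(plusSet P p), Fib P p) :=
  ((fibPlusHomeomorph P p : ↥(fibPlusSet P p) ≃ₜ Fib P p) : C(↥(fibPlusSet P p), Fib P p)).comp
    (IsHurewiczFibration.retractFibre (hpPlus P hp) (puncturedSphereContraction P.w ⟨P.v, P.v_mem_capV⟩))

/-- `ι₊ ∘ R₊ ≃ 𝟙` on `E₊`. [cite: HatcherAT2002, §4.2 Cor. 4.63] -/
theorem fibInclPlus_comp_retr_homotopic (hp : IsHurewiczFibration.{0, 0, 0} p) :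
    ((fibInclPlus P p).comp (retr P hp)).Homotopic (ContinuousMap.id _) := by
  have h := (IsHurewiczFibration.homotopyEquivFibre (hpPlus P hp)
    (puncturedSphereContraction P.w ⟨P.v, P.v_mem_capV⟩)).right_inv
  have hfac : (fibInclPlus P p).comp (retr P hp) =
      (⟨Subtype.val, continuous_subtype_val⟩ : C(_, ↥(plusSet P p))).comp
        (IsHurewiczFibration.retractFibre (hpPlus P hp) (puncturedSphereContraction P.w ⟨P.v, P.v_mem_capV⟩)) := by
    ext e : 1; rfl
  rw [hfac]
  exact h

/-- `R₊ ∘ ι₊ ≃ 𝟙` on `F`. [cite: HatcherAT2002, §4.2 Cor. 4.63] -/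
theorem retr_comp_fibInclPlus_homotopic (hp : IsHurewiczFibration.{0, 0, 0} p) :
    ((retr P hp).comp (fibInclPlus P p)).Homotopic (ContinuousMap.id _) := by
  have h := (IsHurewiczFibration.homotopyEquivFibre (hpPlus P hp)
    (puncturedSphereContraction P.w ⟨P.v, P.v_mem_capV⟩)).left_inv
  let φ : C(↥(fibPlusSet P p), Fib P p) := ((fibPlusHomeomorph P p : ↥(fibPlusSet P p) ≃ₜ Fib P p) : C(↥(fibPlusSet P p), Fib P p))
  let φ' : C(Fib P p, ↥(fibPlusSet P p)) := ((fibPlusHomeomorph P p).symm : C(Fib P p, ↥(fibPlusSet P p)))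
  have hfac : (retr P hp).comp (fibInclPlus P p) =
      φ.comp (((IsHurewiczFibration.retractFibre (hpPlus P hp)
        (puncturedSphereContraction P.w ⟨P.v, P.v_mem_capV⟩)).comp
        (⟨Subtype.val, continuous_subtype_val⟩ : C(↥(fibPlusSet P p), ↥(plusSet P p)))).comp φ') := by
    ext e : 1; rfl
  have hid : φ.comp ((ContinuousMap.id _).comp φ') = ContinuousMap.id _ := by
    ext e : 1; exact (fibPlusHomeomorph P p).apply_symm_apply e
  rw [hfac, ← hid]
  exact ContinuousMap.Homotopic.comp (ContinuousMap.Homotopic.refl _)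
    (ContinuousMap.Homotopic.comp h (ContinuousMap.Homotopic.refl _))

/-- `ι₊^* R₊^* = 𝟙`. [folklore] -/
theorem map_fibInclPlus_map_retr (hp : IsHurewiczFibration.{0, 0, 0} p) (n : ℕ) (y : singularCohomology R R (Fib P p) n) :
    singularCohomology.map R R (fibInclPlus P p) n (singularCohomology.map R R (retr P hp) n y) = y := by
  rw [← ModuleCat.comp_apply, ← singularCohomology.map_comp,
    singularCohomology.map_eq_of_homotopic' R R (retr_comp_fibInclPlus_homotopic P hp) n,
    singularCohomology.map_id, ModuleCat.id_apply]

/-- `R₊^* ι₊^* = 𝟙`. [folklore] -/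
theorem map_retr_map_fibInclPlus (hp : IsHurewiczFibration.{0, 0, 0} p) (n : ℕ) (x : singularCohomology R R ↥(plusSet P p) n) :
    singularCohomology.map R R (retr P hp) n (singularCohomology.map R R (fibInclPlus P p) n x) = x := by
  rw [← ModuleCat.comp_apply, ← singularCohomology.map_comp,
    singularCohomology.map_eq_of_homotopic' R R (fibInclPlus_comp_retr_homotopic P hp) n,
    singularCohomology.map_id, ModuleCat.id_apply]

/-- `ι₊^*` is bijective. [folklore] -/
theorem map_fibInclPlus_bijective (hp : IsHurewiczFibration.{0, 0, 0} p) (n : ℕ) : Bijective (singularCohomology.map R R (fibInclPlus P p) n) :=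
  ⟨fun a b h => by rw [← map_retr_map_fibInclPlus R P hp n a, ← map_retr_map_fibInclPlus R P hp n b, h],
    fun y => ⟨_, map_fibInclPlus_map_retr R P hp n y⟩⟩

end Retraction

/-! #### The band piece is `F × band` up to weak equivalence -/

section Band


/-- **`Ψ : band piece → F × band`**, `e ↦ (R₊ e, p e)`. [cite: Whitehead1978, Ch. VII §7] -/
def psi (hp : IsHurewiczFibration.{0, 0, 0} p) : C(↥(bandPiece P p), Fib P p × ↥P.bandSet) where
  toFun e := (retr P hp e.1, toBand P p e)
  continuous_toFun := ((retr P hp).continuous.comp continuous_subtype_val).prodMk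
    (continuous_toBand P p hp.continuous)

/-- The fibrewise form `Ψ₀ : band piece → bandN × F` over the band in the cap. [folklore] -/
def psiZero (hp : IsHurewiczFibration.{0, 0, 0} p) : C(↥(bandPiece P p), ↥(bandN P) × Fib P p) where
  toFun e := ((bandN P).restrictPreimage (pPlus P p) e, retr P hp e.1)
  continuous_toFun := ((hp.continuous.restrictPreimage (s := P.capV)).restrictPreimage (s := bandN P)).prodMk
    ((retr P hp).continuous.comp continuous_subtype_val)

/-- The fibre inclusion of `p⁻¹(z)` into `E₊` for `z ∈ capV` is a weak equivalence. [cite: Spanier1981, Ch. 9, Sec. 2, Thm. 17] -/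
theorem isWeakHomotopyEquiv_fibre_incl_plus (hpS : IsSerreFibration p) {z : 𝕊 (k + 2)} (hz : z ∈ P.capV) :
    IsWeakHomotopyEquiv (subsetInclusion (preimage_mono (singleton_subset_iff.2 hz) : p ⁻¹' {z} ⊆ plusSet P p)) :=
  hpS.isWeakHomotopyEquiv_preimage_inclusion (singleton_subset_iff.2 hz)
    (SerreCube.isWeakHomotopyEquiv_subsetInclusion_of_contractible _)

/-- The fibre inclusion of `p⁻¹(z)` into `E₋` for `z ∈ capW` is a weak equivalence. [cite: Spanier1981, Ch. 9, Sec. 2, Thm. 17] -/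
theorem isWeakHomotopyEquiv_fibre_incl_minus (hpS : IsSerreFibration p) {z : 𝕊 (k + 2)} (hz : z ∈ P.capW) :
    IsWeakHomotopyEquiv (subsetInclusion (preimage_mono (singleton_subset_iff.2 hz) : p ⁻¹' {z} ⊆ minusSet P p)) :=
  hpS.isWeakHomotopyEquiv_preimage_inclusion (singleton_subset_iff.2 hz)
    (SerreCube.isWeakHomotopyEquiv_subsetInclusion_of_contractible _)

/-- `R₊` is a weak equivalence. [cite: HatcherAT2002, §4.2 Cor. 4.63] -/
theorem isWeakHomotopyEquiv_retr (hp : IsHurewiczFibration.{0, 0, 0} p) (hpS : IsSerreFibration p) : IsWeakHomotopyEquiv (retr P hp) :=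
  IsWeakHomotopyEquiv.of_comp_homotopic_id (isWeakHomotopyEquiv_fibre_incl_plus P hpS P.v_mem_capV)
    (fibInclPlus_comp_retr_homotopic P hp)

/-- **`Ψ₀` is a weak homotopy equivalence** (fibrewise over the band, on each fibre the fibre
inclusion into `E₊` followed by `R₊`). [cite: Whitehead1978, Ch. VII §7] -/
theorem isWeakHomotopyEquiv_psiZero (hp : IsHurewiczFibration.{0, 0, 0} p) (hpS : IsSerreFibration p) : IsWeakHomotopyEquiv (psiZero P hp) := by
  have hq₁ : IsSerreFibration ((bandN P).restrictPreimage (pPlus P p)) :=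
    (hpS.restrictPreimage _).restrictPreimage _
  have hq₂ : IsSerreFibration (Prod.fst : ↥(bandN P) × Fib P p → ↥(bandN P)) := isSerreFibration_fst
  refine hq₁.isWeakHomotopyEquiv_of_fibrewise hq₂ (psiZero P hp) (fun _ => rfl) fun z => ?_
  have hz : ((z : ↥P.capV) : 𝕊 (k + 2)) ∈ P.capV := z.1.2
  set q₁ := (bandN P).restrictPreimage (pPlus P p) with hq₁def
  let ιz : C(↥(p ⁻¹' {((z : ↥P.capV) : 𝕊 (k + 2))}), ↥(plusSet P p)) :=
    subsetInclusion (preimage_mono (singleton_subset_iff.2 hz))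
  have hmemV : ∀ f : ↥(p ⁻¹' {((z : ↥P.capV) : 𝕊 (k + 2))}), p f.1 ∈ P.capV := fun f => by
    rw [show p f.1 = _ from f.2]; exact hz
  have hmemW : ∀ f : ↥(p ⁻¹' {((z : ↥P.capV) : 𝕊 (k + 2))}), p f.1 ∈ P.capW := fun f => by
    rw [show p f.1 = _ from f.2]; exact z.2
  have hto : ∀ e : ↥(q₁ ⁻¹' {z}), e.1.1.1 ∈ p ⁻¹' {((z : ↥P.capV) : 𝕊 (k + 2))} := fun e =>
    congrArg Subtype.val (congrArg Subtype.val (show q₁ e.1 = z from e.2))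
  have hinv : ∀ f : ↥(p ⁻¹' {((z : ↥P.capV) : 𝕊 (k + 2))}),
      (⟨⟨f.1, hmemV f⟩, hmemW f⟩ : ↥(bandPiece P p)) ∈ q₁ ⁻¹' {z} := fun f =>
    show q₁ _ = z from Subtype.ext (Subtype.ext (show p f.1 = _ from f.2))
  let h₁ : ↥(q₁ ⁻¹' {z}) ≃ₜ ↥(p ⁻¹' {((z : ↥P.capV) : 𝕊 (k + 2))}) :=
    { toFun := fun e => ⟨e.1.1.1, hto e⟩
      invFun := fun f => ⟨⟨⟨f.1, hmemV f⟩, hmemW f⟩, hinv f⟩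
      left_inv := fun _ => rfl
      right_inv := fun _ => rfl
      continuous_toFun := ((continuous_subtype_val.comp continuous_subtype_val).comp continuous_subtype_val).subtype_mk hto
      continuous_invFun := (((continuous_subtype_val.subtype_mk hmemV).subtype_mk hmemW).subtype_mk hinv) }
  let h₂ : Fib P p ≃ₜ ↥((Prod.fst : ↥(bandN P) × Fib P p → ↥(bandN P)) ⁻¹' {z}) :=
    { toFun := fun f => ⟨(z, f), rfl⟩
      invFun := fun e => e.1.2
      left_inv := fun _ => rfl
      right_inv := fun e => by
        apply Subtype.ext
        exact Prod.ext (show z = e.1.1 from (e.2 : e.1.1 = z).symm) rfl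
      continuous_toFun := (continuous_const.prodMk continuous_id).subtype_mk _
      continuous_invFun := continuous_snd.comp continuous_subtype_val }
  have hfac : fibreMap (p := q₁) (p' := (Prod.fst : ↥(bandN P) × Fib P p → ↥(bandN P))) (psiZero P hp) (fun _ => rfl) z =
      (h₂ : C(Fib P p, _)).comp (((retr P hp).comp ιz).comp (h₁ : C(↥(q₁ ⁻¹' {z}), _))) := by
    ext e : 1
    apply Subtype.ext
    exact Prod.ext (show q₁ e.1 = z from e.2) rfl
  rw [hfac]
  exact (IsWeakHomotopyEquiv.of_homeomorph h₂).comp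
    (((isWeakHomotopyEquiv_retr P hp hpS).comp (isWeakHomotopyEquiv_fibre_incl_plus P hpS hz)).comp
      (IsWeakHomotopyEquiv.of_homeomorph h₁))

/-- The band in the cap is the band. [folklore] -/
def bandNHomeomorph : ↥(bandN P) ≃ₜ ↥P.bandSet where
  toFun z := ⟨z.1.1, P.mem_bandSet z.1.2 z.2⟩
  invFun y := ⟨⟨y.1, fun h => y.2 (Or.inr h)⟩, fun h => y.2 (Or.inl h)⟩
  left_inv _ := rfl
  right_inv _ := rfl
  continuous_toFun := (continuous_subtype_val.comp continuous_subtype_val).subtype_mk _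
  continuous_invFun := (continuous_subtype_val.subtype_mk _).subtype_mk _

/-- `Ψ = (swap ∘ (bandNHomeomorph × 𝟙)) ∘ Ψ₀`. [folklore] -/
theorem psi_eq_comp (hp : IsHurewiczFibration.{0, 0, 0} p) : psi P hp = ((ContinuousMap.prodSwap : C(_ , _)).comp
    (((bandNHomeomorph P : C(↥(bandN P), ↥P.bandSet)).prodMap (ContinuousMap.id (Fib P p))))).comp (psiZero P hp) := by
  ext e : 1; rfl

/-- **`Ψ` is a weak homotopy equivalence.** [cite: Whitehead1978, Ch. VII §7] -/
theorem isWeakHomotopyEquiv_psi (hp : IsHurewiczFibration.{0, 0, 0} p) (hpS : IsSerreFibration p) : IsWeakHomotopyEquiv (psi P hp) := by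
  rw [psi_eq_comp]
  refine IsWeakHomotopyEquiv.comp ?_ (isWeakHomotopyEquiv_psiZero P hp hpS)
  exact (IsWeakHomotopyEquiv.of_homeomorph (Homeomorph.prodComm _ _)).comp
    (IsWeakHomotopyEquiv.of_homeomorph ((bandNHomeomorph P).prodCongr (Homeomorph.refl _)))

/-- **`Ψ^* : Hⁿ(F × band) → Hⁿ(band piece)` is bijective.** [cite: Whitehead1978, Ch. VII §7] -/
theorem map_psi_bijective (hp : IsHurewiczFibration.{0, 0, 0} p) (hpS : IsSerreFibration p) (n : ℕ) : Bijective (singularCohomology.map R R (psi P hp) n) :=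
  bijective_singularCohomology_map_of_isWeakHomotopyEquiv R _ (isWeakHomotopyEquiv_psi P hp hpS) n

end Band

/-! #### The identifications: `ψ : H(E₋) ≅ H(F)` and the clutching map `T` -/

section Clutching


/-- `R' = R₊ ∘ ι₀ : F₀ → F` (transport of the fibre over `x₀` to the fibre over `v` inside `E₊`).
[folklore] -/
abbrev transp (hp : IsHurewiczFibration.{0, 0, 0} p) : C(Fib0 P p, Fib P p) := (retr P hp).comp (fib0InclPlus P p)

/-- `R'^*` is bijective. [folklore] -/
theorem map_transp_bijective (hp : IsHurewiczFibration.{0, 0, 0} p) (hpS : IsSerreFibration p) (n : ℕ) : Bijective (singularCohomology.map R R (transp P hp) n) :=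
  bijective_singularCohomology_map_of_isWeakHomotopyEquiv R _
    ((isWeakHomotopyEquiv_retr P hp hpS).comp (isWeakHomotopyEquiv_fibre_incl_plus P hpS P.x₀_mem_capV)) n

/-- `(F₀ ↪ E₋)^*` is bijective. [folklore] -/
theorem map_fib0InclMinus_bijective (hpS : IsSerreFibration p) (n : ℕ) : Bijective (singularCohomology.map R R (fib0InclMinus P p) n) :=
  bijective_singularCohomology_map_of_isWeakHomotopyEquiv R _ (isWeakHomotopyEquiv_fibre_incl_minus P hpS P.x₀_mem_capW) n

/-- `R'^*` as a linear equivalence `Hⁿ(F) ≃ Hⁿ(F₀)`. [folklore] -/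
def eTransp (hp : IsHurewiczFibration.{0, 0, 0} p) (hpS : IsSerreFibration p) (n : ℕ) : singularCohomology R R (Fib P p) n ≃ₗ[R] singularCohomology R R (Fib0 P p) n :=
  LinearEquiv.ofBijective (singularCohomology.map R R (transp P hp) n).hom (map_transp_bijective R P hp hpS n)

/-- `(F₀ ↪ E₋)^*` as a linear equivalence `Hⁿ(E₋) ≃ Hⁿ(F₀)`. [folklore] -/
def eMinus (hpS : IsSerreFibration p) (n : ℕ) : singularCohomology R R ↥(minusSet P p) n ≃ₗ[R] singularCohomology R R (Fib0 P p) n :=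
  LinearEquiv.ofBijective (singularCohomology.map R R (fib0InclMinus P p) n).hom (map_fib0InclMinus_bijective R P hpS n)

/-- `Ψ^*` as a linear equivalence `Hⁿ(F × band) ≃ Hⁿ(band piece)`. [folklore] -/
def ePsi (hp : IsHurewiczFibration.{0, 0, 0} p) (hpS : IsSerreFibration p) (n : ℕ) : singularCohomology R R (Fib P p × ↥P.bandSet) n ≃ₗ[R] singularCohomology R R ↥(bandPiece P p) n :=
  LinearEquiv.ofBijective (singularCohomology.map R R (psi P hp) n).hom (map_psi_bijective R P hp hpS n)

/-- `eTransp y = R'^* y`. [folklore] -/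
@[simp] theorem eTransp_apply (hp : IsHurewiczFibration.{0, 0, 0} p) (hpS : IsSerreFibration p) (n : ℕ) (y : singularCohomology R R (Fib P p) n) :
    eTransp R P hp hpS n y = singularCohomology.map R R (transp P hp) n y := rfl

/-- `eMinus z = (F₀ ↪ E₋)^* z`. [folklore] -/
@[simp] theorem eMinus_apply (hpS : IsSerreFibration p) (n : ℕ) (z : singularCohomology R R ↥(minusSet P p) n) :
    eMinus R P hpS n z = singularCohomology.map R R (fib0InclMinus P p) n z := rfl

/-- `ePsi x = Ψ^* x`. [folklore] -/
@[simp] theorem ePsi_apply (hp : IsHurewiczFibration.{0, 0, 0} p) (hpS : IsSerreFibration p) (n : ℕ) (x : singularCohomology R R (Fib P p × ↥P.bandSet) n) :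
    ePsi R P hp hpS n x = singularCohomology.map R R (psi P hp) n x := rfl

/-- **`ψ : Hⁿ(E₋) ≃ Hⁿ(F)`**, `z ↦ (R'^*)⁻¹ (z|_{F₀})`. [cite: Whitehead1978, Ch. VII §7] -/
def psiH (hp : IsHurewiczFibration.{0, 0, 0} p) (hpS : IsSerreFibration p) (n : ℕ) : singularCohomology R R ↥(minusSet P p) n ≃ₗ[R] singularCohomology R R (Fib P p) n :=
  (eMinus R P hpS n).trans (eTransp R P hp hpS n).symm

/-- **The clutching map `T : Hⁿ(F) → Hⁿ(F × band)`**: `T = (Ψ^*)⁻¹ ∘ (band piece ↪ E₋)^* ∘ ψ⁻¹`.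
[cite: Whitehead1978, Ch. VII §7, Thm. 7.14] -/
def T (hp : IsHurewiczFibration.{0, 0, 0} p) (hpS : IsSerreFibration p) (n : ℕ) : singularCohomology R R (Fib P p) n →ₗ[R] singularCohomology R R (Fib P p × ↥P.bandSet) n :=
  (ePsi R P hp hpS n).symm.toLinearMap ∘ₗ (singularCohomology.map R R (bandToMinus P p) n).hom ∘ₗ
    ((psiH R P hp hpS n).symm : singularCohomology R R (Fib P p) n →ₗ[R] singularCohomology R R ↥(minusSet P p) n)

/-- `Ψ^* (T (ψ z)) = z|_{band piece}`. [folklore] -/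
theorem map_psi_T_psiH (hp : IsHurewiczFibration.{0, 0, 0} p) (hpS : IsSerreFibration p) (n : ℕ) (z : singularCohomology R R ↥(minusSet P p) n) :
    singularCohomology.map R R (psi P hp) n (T R P hp hpS n (psiH R P hp hpS n z)) =
      singularCohomology.map R R (bandToMinus P p) n z := by
  simp only [T, psiH, LinearMap.coe_comp, LinearEquiv.coe_coe, comp_apply, LinearEquiv.symm_apply_apply,
    LinearEquiv.trans_apply, LinearEquiv.symm_trans_apply]
  rw [← ePsi_apply R P hp hpS, LinearEquiv.apply_symm_apply]

/-- **`ψ (x|_{E₋}) = ι^* x`**: under `ψ` the restriction to `E₋` is the restriction to the fibre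
(the transport `R'` is homotopic, in `E`, to the inclusion of `F₀`). [cite: Whitehead1978, Ch. VII §7] -/
theorem psiH_map_subsetIncl (hp : IsHurewiczFibration.{0, 0, 0} p) (hpS : IsSerreFibration p) (n : ℕ) (x : singularCohomology R R E n) :
    psiH R P hp hpS n (singularCohomology.map R R (subsetIncl (minusSet P p)) n x) =
      singularCohomology.map R R (fibIncl P p) n x := by
  rw [psiH, LinearEquiv.trans_apply, LinearEquiv.symm_apply_eq, eTransp_apply, eMinus_apply,
    ← ModuleCat.comp_apply, ← singularCohomology.map_comp, ← ModuleCat.comp_apply, ← singularCohomology.map_comp]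
  -- `F₀ ↪ E` versus `F₀ → E₊ →R₊ F ↪ E`: homotopic through `ι₊ ∘ R₊ ≃ 𝟙`
  have hhom : ((fibIncl P p).comp (transp P hp)).Homotopic ((subsetIncl (minusSet P p)).comp (fib0InclMinus P p)) := by
    have hfac1 : (fibIncl P p).comp (transp P hp) =
        (subsetIncl (plusSet P p)).comp (((fibInclPlus P p).comp (retr P hp)).comp (fib0InclPlus P p)) := by
      ext e : 1; rfl
    have hfac2 : (subsetIncl (minusSet P p)).comp (fib0InclMinus P p) =
        (subsetIncl (plusSet P p)).comp ((ContinuousMap.id _).comp (fib0InclPlus P p)) := by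
      ext e : 1; rfl
    rw [hfac1, hfac2]
    exact ContinuousMap.Homotopic.comp (ContinuousMap.Homotopic.refl _)
      (ContinuousMap.Homotopic.comp (fibInclPlus_comp_retr_homotopic P hp) (ContinuousMap.Homotopic.refl _))
  rw [singularCohomology.map_eq_of_homotopic' R R hhom n]

/-- The slice through `x₀` after `R'` is `Ψ` on the fibre `F₀`. [folklore] -/
theorem sliceAt_comp_transp (hp : IsHurewiczFibration.{0, 0, 0} p) : (sliceAt (U := Fib P p) (⟨P.x₀, P.x₀_mem_bandSet⟩ : ↥P.bandSet)).comp (transp P hp) =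
    (psi P hp).comp (fib0InclBand P p) := by
  ext f : 1
  refine Prod.ext ?_ (Subtype.ext ?_)
  · rfl
  · exact (show p f.1 = P.x₀ from f.2).symm

/-- **The slice splits `T`**: `s_{x₀}^* (T y) = y`. [cite: Whitehead1978, Ch. VII §7] -/
theorem map_sliceAt_T (hp : IsHurewiczFibration.{0, 0, 0} p) (hpS : IsSerreFibration p) (n : ℕ) (y : singularCohomology R R (Fib P p) n) :
    singularCohomology.map R R (sliceAt (U := Fib P p) (⟨P.x₀, P.x₀_mem_bandSet⟩ : ↥P.bandSet)) n (T R P hp hpS n y) = y := by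
  apply (map_transp_bijective R P hp hpS n).1
  rw [← ModuleCat.comp_apply, ← singularCohomology.map_comp, sliceAt_comp_transp P hp,
    singularCohomology.map_comp, ModuleCat.comp_apply]
  -- `Ψ^* (T y) = (band piece ↪ E₋)^* (ψ⁻¹ y)`
  set z := (psiH R P hp hpS n).symm y with hz
  have hy : y = psiH R P hp hpS n z := by rw [hz, LinearEquiv.apply_symm_apply]
  rw [hy, map_psi_T_psiH, ← ModuleCat.comp_apply, ← singularCohomology.map_comp]
  change singularCohomology.map R R (fib0InclMinus P p) n z = _
  rw [psiH, LinearEquiv.trans_apply, ← eMinus_apply R P hpS, ← eTransp_apply R P hp hpS, LinearEquiv.apply_symm_apply]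

/-- Multiplicativity of the inverse of a multiplicative bijection. [folklore] -/
theorem symm_cupProduct {X Y : Type} [TopologicalSpace X] [TopologicalSpace Y] (f : C(X, Y))
    (hf : ∀ n, Bijective (singularCohomology.map R R f n)) {a b n : ℕ} (h : a + b = n)
    (x : singularCohomology R R X a) (y : singularCohomology R R X b) :
    (LinearEquiv.ofBijective (singularCohomology.map R R f n).hom (hf n)).symm (cupProduct h x y) =
      cupProduct h ((LinearEquiv.ofBijective (singularCohomology.map R R f a).hom (hf a)).symm x)
        ((LinearEquiv.ofBijective (singularCohomology.map R R f b).hom (hf b)).symm y) := by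
  apply (hf n).1
  change (LinearEquiv.ofBijective (singularCohomology.map R R f n).hom (hf n))
      ((LinearEquiv.ofBijective (singularCohomology.map R R f n).hom (hf n)).symm (cupProduct h x y)) = _
  rw [LinearEquiv.apply_symm_apply, cupProduct_map]
  change _ = cupProduct h ((LinearEquiv.ofBijective (singularCohomology.map R R f a).hom (hf a))
      ((LinearEquiv.ofBijective (singularCohomology.map R R f a).hom (hf a)).symm x))
    ((LinearEquiv.ofBijective (singularCohomology.map R R f b).hom (hf b))
      ((LinearEquiv.ofBijective (singularCohomology.map R R f b).hom (hf b)).symm y))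
  rw [LinearEquiv.apply_symm_apply, LinearEquiv.apply_symm_apply]

/-- **`T` is multiplicative**: `T (a ⌣ b) = T a ⌣ T b` (a composite of ring maps and inverses of
ring isomorphisms). [cite: Whitehead1978, Ch. VII §7, Thm. 7.14] -/
theorem T_cupProduct (hp : IsHurewiczFibration.{0, 0, 0} p) (hpS : IsSerreFibration p) {a b n : ℕ} (h : a + b = n) (x : singularCohomology R R (Fib P p) a)
    (y : singularCohomology R R (Fib P p) b) :
    T R P hp hpS n (cupProduct h x y) = cupProduct h (T R P hp hpS a x) (T R P hp hpS b y) := by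
  simp only [T, psiH, LinearMap.coe_comp, LinearEquiv.coe_coe, comp_apply, LinearEquiv.symm_trans_apply,
    LinearEquiv.symm_symm]
  rw [eTransp_apply, cupProduct_map]
  change (ePsi R P hp hpS n).symm (singularCohomology.map R R (bandToMinus P p) n
      ((eMinus R P hpS n).symm (cupProduct h _ _))) = _
  rw [show (eMinus R P hpS n).symm (cupProduct h (singularCohomology.map R R (transp P hp) a x)
        (singularCohomology.map R R (transp P hp) b y)) = cupProduct h ((eMinus R P hpS a).symm
          (singularCohomology.map R R (transp P hp) a x)) ((eMinus R P hpS b).symm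
          (singularCohomology.map R R (transp P hp) b y)) from
      symm_cupProduct R (fib0InclMinus P p) (map_fib0InclMinus_bijective R P hpS) h _ _,
    cupProduct_map]
  exact symm_cupProduct R (psi P hp) (map_psi_bijective R P hp hpS) h _ _

end Clutching

/-! #### The Künneth decomposition of `T`: the derivation `D` -/

section Derivation


/-- In positive degree a class pulled back along a constant map vanishes. [folklore] -/
theorem map_const_eq_zero {X Z : Type} [TopologicalSpace X] [TopologicalSpace Z] (z : Z) {n : ℕ} (hn : n ≠ 0)
    (x : singularCohomology R R Z n) : singularCohomology.map R R (ContinuousMap.const X z) n x = 0 := by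
  have hfac : ContinuousMap.const X z = (ContinuousMap.const PUnit.{1} z).comp (ContinuousMap.const X PUnit.unit) := by
    ext; rfl
  rw [hfac, singularCohomology.map_comp, ModuleCat.comp_apply,
    ModuleCat.eq_zero_of_isZero_obj (singularCochainComplex.isZero_singularCohomology_of_subsingleton' (R := R) (M := R)
      (X := PUnit.{1}) hn) (singularCohomology.map R R (ContinuousMap.const PUnit.{1} z) n x), map_zero]

/-- The slice kills the `gen`-part: `s^*(pr₂^* g ⌣ pr₁^* c) = 0`. [folklore] -/
theorem map_sliceAt_cupProduct_gen (i : ℕ) (c : singularCohomology R R (Fib P p) i) (c₀ : ↥P.bandSet) :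
    singularCohomology.map R R (sliceAt (U := Fib P p) c₀) (i + (k + 1))
      (cupProduct (Nat.add_comm (k + 1) i)
        (singularCohomology.map R R (ContinuousMap.snd : C(Fib P p × ↥P.bandSet, ↥P.bandSet)) (k + 1) (P.gen R))
        (singularCohomology.map R R (ContinuousMap.fst : C(Fib P p × ↥P.bandSet, Fib P p)) i c)) = 0 := by
  rw [cupProduct_map, ← ModuleCat.comp_apply, ← singularCohomology.map_comp]
  change cupProduct _ (singularCohomology.map R R (ContinuousMap.const (Fib P p) c₀) (k + 1) (P.gen R)) _ = 0
  rw [map_const_eq_zero R c₀ (Nat.succ_ne_zero k), LinearMap.map_zero, LinearMap.zero_apply]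

/-- `s^* (sphereSplit (y, c)) = y`. [folklore] -/
theorem map_sliceAt_sphereSplit (i : ℕ) (y : singularCohomology R R (Fib P p) (i + (k + 1)))
    (c : singularCohomology R R (Fib P p) i) (c₀ : ↥P.bandSet) :
    singularCohomology.map R R (sliceAt (U := Fib P p) c₀) (i + (k + 1)) (sphereSplit R (P.gen R) (Fib P p) i (y, c)) = y := by
  rw [sphereSplit_apply, map_add, map_sliceAt_map_fst, map_sliceAt_cupProduct_gen, add_zero]

/-- `sphereSplit` is compatible with scalars. [folklore] -/
theorem sphereSplit_smul (i : ℕ) (r : R) (x : singularCohomology R R (Fib P p) (i + (k + 1)) × singularCohomology R R (Fib P p) i) :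
    sphereSplit R (P.gen R) (Fib P p) i (r • x) = r • sphereSplit R (P.gen R) (Fib P p) i x := by
  obtain ⟨a, c⟩ := x
  simp only [Prod.smul_mk, sphereSplit_apply, map_smul, smul_add]

/-- The `Hⁱ(F)`-component of `T y` in the Künneth decomposition (as a function). [folklore] -/
def dFun (hp : IsHurewiczFibration.{0, 0, 0} p) (hpS : IsSerreFibration p) (i : ℕ) (y : singularCohomology R R (Fib P p) (i + (k + 1))) : singularCohomology R R (Fib P p) i :=
  ((Equiv.ofBijective _ ((P.isCupSphere_gen R).split (Fib P p) i)).symm (T R P hp hpS (i + (k + 1)) y)).2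

/-- **`T y = pr₁^* y + pr₂^* g ⌣ pr₁^*(D y)`** in degree `i + (k+1)` (Künneth decomposition; the
`pr₁^*`-component is `y` by the slice). [cite: Whitehead1978, Ch. VII §7, Thm. 7.14] -/
theorem T_eq_sphereSplit_dFun (hp : IsHurewiczFibration.{0, 0, 0} p) (hpS : IsSerreFibration p) (i : ℕ) (y : singularCohomology R R (Fib P p) (i + (k + 1))) :
    T R P hp hpS (i + (k + 1)) y = sphereSplit R (P.gen R) (Fib P p) i (y, dFun R P hp hpS i y) := by
  set e := Equiv.ofBijective _ ((P.isCupSphere_gen R).split (Fib P p) i) with he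
  have h1 : T R P hp hpS (i + (k + 1)) y = sphereSplit R (P.gen R) (Fib P p) i (e.symm (T R P hp hpS (i + (k + 1)) y)) :=
    (e.apply_symm_apply _).symm
  have hy : (e.symm (T R P hp hpS (i + (k + 1)) y)).1 = y := by
    have h2 := congrArg (singularCohomology.map R R (sliceAt (U := Fib P p) (⟨P.x₀, P.x₀_mem_bandSet⟩ : ↥P.bandSet)) (i + (k + 1))) h1
    rw [map_sliceAt_T] at h2
    conv_rhs => rw [h2]
    rw [← Prod.mk.eta (p := e.symm _), map_sliceAt_sphereSplit]
  conv_lhs => rw [h1, ← Prod.mk.eta (p := e.symm _), hy]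
  rfl

/-- **Wang's derivation `D : H^{i+(k+1)}(F) → Hⁱ(F)`** (`θ` of Whitehead VII.7.14), the
`Hⁱ(F)`-component of the clutching map `T`. [cite: Whitehead1978, Ch. VII §7, Thm. 7.14] -/
def D (hp : IsHurewiczFibration.{0, 0, 0} p) (hpS : IsSerreFibration p) (i : ℕ) : singularCohomology R R (Fib P p) (i + (k + 1)) →ₗ[R] singularCohomology R R (Fib P p) i where
  toFun := dFun R P hp hpS i
  map_add' y y' := by
    have hinj := ((P.isCupSphere_gen R).split (Fib P p) i).1
    have h := T_eq_sphereSplit_dFun R P hp hpS i (y + y')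
    rw [map_add, T_eq_sphereSplit_dFun, T_eq_sphereSplit_dFun] at h
    have key : sphereSplit R (P.gen R) (Fib P p) i (y + y', dFun R P hp hpS i y + dFun R P hp hpS i y') =
        sphereSplit R (P.gen R) (Fib P p) i (y + y', dFun R P hp hpS i (y + y')) := by
      rw [← h]
      simp only [sphereSplit_apply, map_add]
      abel
    have h3 := hinj key
    simp only [Prod.mk.injEq] at h3
    exact h3.2.symm
  map_smul' r y := by
    have hinj := ((P.isCupSphere_gen R).split (Fib P p) i).1
    have h := T_eq_sphereSplit_dFun R P hp hpS i (r • y)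
    rw [map_smul, T_eq_sphereSplit_dFun] at h
    have key : sphereSplit R (P.gen R) (Fib P p) i (r • y, r • dFun R P hp hpS i y) =
        sphereSplit R (P.gen R) (Fib P p) i (r • y, dFun R P hp hpS i (r • y)) := by
      rw [← h, ← Prod.smul_mk, sphereSplit_smul]
    have h3 := hinj key
    simp only [Prod.mk.injEq] at h3
    exact h3.2.symm

/-- `D y` is the `Hⁱ(F)`-component. [folklore] -/
theorem D_apply (hp : IsHurewiczFibration.{0, 0, 0} p) (hpS : IsSerreFibration p) (i : ℕ) (y : singularCohomology R R (Fib P p) (i + (k + 1))) : D R P hp hpS i y = dFun R P hp hpS i y := rfl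

/-- **`T y = pr₁^* y + pr₂^* g ⌣ pr₁^*(D y)`.** [cite: Whitehead1978, Ch. VII §7, Thm. 7.14] -/
theorem T_eq_sphereSplit (hp : IsHurewiczFibration.{0, 0, 0} p) (hpS : IsSerreFibration p) (i : ℕ) (y : singularCohomology R R (Fib P p) (i + (k + 1))) :
    T R P hp hpS (i + (k + 1)) y = sphereSplit R (P.gen R) (Fib P p) i (y, D R P hp hpS i y) :=
  T_eq_sphereSplit_dFun R P hp hpS i y

/-- Uniqueness of the decomposition: `T y = sphereSplit (y', b)` forces `y' = y` and `b = D y`.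
[folklore] -/
theorem eq_D_of_T_eq (hp : IsHurewiczFibration.{0, 0, 0} p) (hpS : IsSerreFibration p) (i : ℕ) (y y' : singularCohomology R R (Fib P p) (i + (k + 1))) (b : singularCohomology R R (Fib P p) i)
    (h : T R P hp hpS (i + (k + 1)) y = sphereSplit R (P.gen R) (Fib P p) i (y', b)) : y' = y ∧ b = D R P hp hpS i y := by
  rw [T_eq_sphereSplit] at h
  have h3 := ((P.isCupSphere_gen R).split (Fib P p) i).1 h
  simp only [Prod.mk.injEq] at h3
  exact ⟨h3.1.symm, h3.2.symm⟩

/-- **Below degree `k + 1`, `T y = pr₁^* y`.** [cite: Whitehead1978, Ch. VII §7] -/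
theorem T_eq_map_fst_of_lt (hp : IsHurewiczFibration.{0, 0, 0} p) (hpS : IsSerreFibration p) {q : ℕ} (hq : q < k + 1) (y : singularCohomology R R (Fib P p) q) :
    T R P hp hpS q y = singularCohomology.map R R (ContinuousMap.fst : C(Fib P p × ↥P.bandSet, Fib P p)) q y := by
  obtain ⟨y', hy'⟩ := ((P.isCupSphere_gen R).low (Fib P p) q hq).2 (T R P hp hpS q y)
  have h2 := congrArg (singularCohomology.map R R (sliceAt (U := Fib P p) (⟨P.x₀, P.x₀_mem_bandSet⟩ : ↥P.bandSet)) q) hy'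
  rw [map_sliceAt_map_fst, map_sliceAt_T] at h2
  rw [← hy', h2]

/-- `g ⌣ g = 0` on the band (a cup-sphere of positive level). [folklore] -/
theorem cupProduct_gen_gen {n : ℕ} (h : (k + 1) + (k + 1) = n) : cupProduct h (P.gen R) (P.gen R) = 0 :=
  (P.isCupSphere_gen R).eq_zero_of_ne (by omega) (by omega) _

/-- **Derivation property, mixed degrees**: for `z` of degree `b < k + 1`,
`D (y ⌣ z) = D y ⌣ z`. [cite: Whitehead1978, Ch. VII §7, Thm. 7.14] -/
theorem D_cupProduct_of_lt (hp : IsHurewiczFibration.{0, 0, 0} p) (hpS : IsSerreFibration p) {i b : ℕ} (hb : b < k + 1) (y : singularCohomology R R (Fib P p) (i + (k + 1)))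
    (z : singularCohomology R R (Fib P p) b) :
    D R P hp hpS (i + b) (cupProduct (show (i + (k + 1)) + b = (i + b) + (k + 1) by omega) y z) =
      cupProduct rfl (D R P hp hpS i y) z := by
  symm
  refine (eq_D_of_T_eq R P hp hpS (i + b) _ (cupProduct (show (i + (k + 1)) + b = (i + b) + (k + 1) by omega) y z) _ ?_).2
  rw [T_cupProduct, T_eq_sphereSplit, T_eq_map_fst_of_lt R P hp hpS hb, sphereSplit_apply, sphereSplit_apply,
    map_add (cupProduct _), LinearMap.add_apply, cupProduct_map, cupProduct_map]
  congr 1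
  exact cupProduct_assoc (Nat.add_comm (k + 1) i) rfl _ (Nat.add_comm (k + 1) (i + b)) _ _ _

end Derivation

/-! #### The pairs `(E₊, band piece)` and `(E, E₋)` -/

section Pairs


/-- **The restriction `Hⁿ(E₊) → Hⁿ(band piece)` is `Ψ^* ∘ pr₁^* ∘ ι₊^*`** (`ι₊ ∘ R₊ ≃ 𝟙`). [folklore] -/
theorem map_subsetIncl_bandPiece (hp : IsHurewiczFibration.{0, 0, 0} p) (n : ℕ) (x : singularCohomology R R ↥(plusSet P p) n) :
    singularCohomology.map R R (subsetIncl (bandPiece P p)) n x =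
      singularCohomology.map R R (psi P hp) n (singularCohomology.map R R
        (ContinuousMap.fst : C(Fib P p × ↥P.bandSet, Fib P p)) n (singularCohomology.map R R (fibInclPlus P p) n x)) := by
  rw [← ModuleCat.comp_apply, ← ModuleCat.comp_apply, ← singularCohomology.map_comp, ← singularCohomology.map_comp]
  have hhom : ((fibInclPlus P p).comp ((ContinuousMap.fst : C(Fib P p × ↥P.bandSet, Fib P p)).comp (psi P hp))).Homotopic
      (subsetIncl (bandPiece P p)) := by
    have hfac : (fibInclPlus P p).comp ((ContinuousMap.fst : C(Fib P p × ↥P.bandSet, Fib P p)).comp (psi P hp)) =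
        ((fibInclPlus P p).comp (retr P hp)).comp (subsetIncl (bandPiece P p)) := by ext e : 1; rfl
    have hid : subsetIncl (bandPiece P p) = (ContinuousMap.id _).comp (subsetIncl (bandPiece P p)) := by ext e : 1; rfl
    rw [hfac]; conv_rhs => rw [hid]
    exact ContinuousMap.Homotopic.comp (fibInclPlus_comp_retr_homotopic P hp) (ContinuousMap.Homotopic.refl _)
  rw [singularCohomology.map_eq_of_homotopic' R R hhom n]

/-- `Ψ^* (pr₁^* y)` is a restriction from `E₊` (of `R₊^* y`). [folklore] -/
theorem map_psi_map_fst (hp : IsHurewiczFibration.{0, 0, 0} p) (n : ℕ) (y : singularCohomology R R (Fib P p) n) :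
    singularCohomology.map R R (psi P hp) n (singularCohomology.map R R
        (ContinuousMap.fst : C(Fib P p × ↥P.bandSet, Fib P p)) n y) =
      singularCohomology.map R R (subsetIncl (bandPiece P p)) n (singularCohomology.map R R (retr P hp) n y) := by
  rw [map_subsetIncl_bandPiece R P hp, map_fibInclPlus_map_retr]

/-- The restriction `Hⁿ(E₊) → Hⁿ(band piece)` is injective. [folklore] -/
theorem map_subsetIncl_bandPiece_injective (hp : IsHurewiczFibration.{0, 0, 0} p) (hpS : IsSerreFibration p) (n : ℕ) :
    Injective (singularCohomology.map R R (subsetIncl (bandPiece P p)) n) := by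
  intro x x' h
  rw [map_subsetIncl_bandPiece R P hp, map_subsetIncl_bandPiece R P hp] at h
  have h1 := (map_psi_bijective R P hp hpS n).1 h
  have h2 : Injective (singularCohomology.map R R (ContinuousMap.fst : C(Fib P p × ↥P.bandSet, Fib P p)) n) :=
    Function.LeftInverse.injective fun y => map_sliceAt_map_fst R R (C := ↥P.bandSet) (⟨P.x₀, P.x₀_mem_bandSet⟩ : ↥P.bandSet) n y
  exact (map_fibInclPlus_bijective R P hp n).1 (h2 h1)

/-- `Hⁿ(E₊, band piece) → Hⁿ(E₊)` vanishes. [cite: HatcherAT2002, §3.1 p. 200] -/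
theorem toAbsolute_bandPiece_eq_zero (hp : IsHurewiczFibration.{0, 0, 0} p) (hpS : IsSerreFibration p) (n : ℕ) (r : relSingularCohomology R R ↥(plusSet P p) (bandPiece P p) n) :
    relSingularCohomology.toAbsolute R R _ (bandPiece P p) n r = 0 := by
  apply map_subsetIncl_bandPiece_injective R P hp hpS n
  rw [map_zero, ← ModuleCat.comp_apply, toAbsolute_comp_map_subsetIncl]
  rfl

/-- `δ : Hⁱ(band piece) → Hⁱ⁺¹(E₊, band piece)` is onto. [cite: HatcherAT2002, §3.1 p. 200] -/
theorem δ_bandPiece_surjective (hp : IsHurewiczFibration.{0, 0, 0} p) (hpS : IsSerreFibration p) (i : ℕ) :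
    Surjective (relSingularCohomology.δ R R ↥(plusSet P p) (bandPiece P p) i (i + 1) rfl) := by
  intro r
  have ex := relSingularCohomology.exact_δ_toAbsolute (R := R) (M := R) (X := ↥(plusSet P p)) (bandPiece P p) i (i + 1) rfl
  rw [ShortComplex.moduleCat_exact_iff] at ex
  exact ex r (toAbsolute_bandPiece_eq_zero R P hp hpS (i + 1) r)

/-- `ker δ = range (restriction from E₊)` on `Hⁱ(band piece)`. [cite: HatcherAT2002, §3.1 p. 200] -/
theorem δ_bandPiece_eq_zero_iff (i : ℕ) (a : singularCohomology R R ↥(bandPiece P p) i) :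
    relSingularCohomology.δ R R ↥(plusSet P p) (bandPiece P p) i (i + 1) rfl a = 0 ↔
      ∃ x, singularCohomology.map R R (subsetIncl (bandPiece P p)) i x = a := by
  have ex := relSingularCohomology.exact_map_δ (R := R) (M := R) (X := ↥(plusSet P p)) (bandPiece P p) i (i + 1) rfl
  rw [ShortComplex.moduleCat_exact_iff] at ex
  constructor
  · intro h; exact ex a h
  · rintro ⟨x, rfl⟩
    rw [← ModuleCat.comp_apply, map_subsetIncl_comp_δ]; rfl

/-- **`λ' : Hⁱ(F) → H^{i+k+2}(E₊, band piece)`**, `b ↦ δ (Ψ^* (pr₂^* g ⌣ pr₁^* b))`. [cite: Whitehead1978, Ch. VII §7] -/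
def lamRel (hp : IsHurewiczFibration.{0, 0, 0} p) (i : ℕ) : singularCohomology R R (Fib P p) i →ₗ[R]
    relSingularCohomology R R ↥(plusSet P p) (bandPiece P p) (i + (k + 1) + 1) :=
  (relSingularCohomology.δ R R ↥(plusSet P p) (bandPiece P p) (i + (k + 1)) (i + (k + 1) + 1) rfl).hom ∘ₗ
    (singularCohomology.map R R (psi P hp) (i + (k + 1))).hom ∘ₗ
      (cupProduct (Nat.add_comm (k + 1) i) (singularCohomology.map R R
        (ContinuousMap.snd : C(Fib P p × ↥P.bandSet, ↥P.bandSet)) (k + 1) (P.gen R))) ∘ₗ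
        (singularCohomology.map R R (ContinuousMap.fst : C(Fib P p × ↥P.bandSet, Fib P p)) i).hom

/-- `λ' b = δ (Ψ^* (sphereSplit (0, b)))`. [folklore] -/
theorem lamRel_apply (hp : IsHurewiczFibration.{0, 0, 0} p) (i : ℕ) (b : singularCohomology R R (Fib P p) i) :
    lamRel R P hp i b = relSingularCohomology.δ R R ↥(plusSet P p) (bandPiece P p) (i + (k + 1)) (i + (k + 1) + 1) rfl
      (singularCohomology.map R R (psi P hp) (i + (k + 1)) (sphereSplit R (P.gen R) (Fib P p) i (0, b))) := by
  rw [sphereSplit_apply, map_zero, zero_add]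
  rfl

/-- `δ (Ψ^* (sphereSplit (y, b))) = λ' b` (the `pr₁^*`-part is a restriction from `E₊`). [folklore] -/
theorem δ_map_psi_sphereSplit (hp : IsHurewiczFibration.{0, 0, 0} p) (i : ℕ) (y : singularCohomology R R (Fib P p) (i + (k + 1))) (b : singularCohomology R R (Fib P p) i) :
    relSingularCohomology.δ R R ↥(plusSet P p) (bandPiece P p) (i + (k + 1)) (i + (k + 1) + 1) rfl
      (singularCohomology.map R R (psi P hp) (i + (k + 1)) (sphereSplit R (P.gen R) (Fib P p) i (y, b))) = lamRel R P hp i b := by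
  have hsplit : sphereSplit R (P.gen R) (Fib P p) i (y, b) =
      singularCohomology.map R R (ContinuousMap.fst : C(Fib P p × ↥P.bandSet, Fib P p)) (i + (k + 1)) y +
        sphereSplit R (P.gen R) (Fib P p) i (0, b) := by
    simp [sphereSplit_apply]
  rw [hsplit, map_add, map_add, lamRel_apply, map_psi_map_fst R P hp, ← ModuleCat.comp_apply, map_subsetIncl_comp_δ]
  change (0 : relSingularCohomology R R ↥(plusSet P p) (bandPiece P p) _) + _ = _
  rw [zero_add]

/-- **`λ'` is bijective.** [cite: Whitehead1978, Ch. VII §7] -/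
theorem lamRel_bijective (hp : IsHurewiczFibration.{0, 0, 0} p) (hpS : IsSerreFibration p) (i : ℕ) : Bijective (lamRel R P hp i) := by
  constructor
  · rw [injective_iff_map_eq_zero]
    intro b hb
    rw [lamRel_apply, δ_bandPiece_eq_zero_iff] at hb
    obtain ⟨x, hx⟩ := hb
    rw [map_subsetIncl_bandPiece R P hp] at hx
    have h1 := (map_psi_bijective R P hp hpS _).1 hx
    have h2 : sphereSplit R (P.gen R) (Fib P p) i (singularCohomology.map R R (fibInclPlus P p) (i + (k + 1)) x, 0) =
        sphereSplit R (P.gen R) (Fib P p) i (0, b) := by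
      rw [← h1]; simp [sphereSplit_apply]
    have h3 := ((P.isCupSphere_gen R).split (Fib P p) i).1 h2
    simp only [Prod.mk.injEq] at h3
    exact h3.2.symm
  · intro r
    obtain ⟨a, rfl⟩ := δ_bandPiece_surjective R P hp hpS (i + (k + 1)) r
    obtain ⟨x, rfl⟩ := (map_psi_bijective R P hp hpS _).2 a
    obtain ⟨⟨y, b⟩, rfl⟩ := ((P.isCupSphere_gen R).split (Fib P p) i).2 x
    exact ⟨b, (δ_map_psi_sphereSplit R P hp i y b).symm⟩

/-- **`Hᵠ(E₊, band piece) = 0` for `q ≤ k + 1`.** [cite: Whitehead1978, Ch. VII §7] -/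
theorem rel_eq_zero_of_le (hp : IsHurewiczFibration.{0, 0, 0} p) (hpS : IsSerreFibration p) {q : ℕ} (hq : q ≤ k + 1) (r : relSingularCohomology R R ↥(plusSet P p) (bandPiece P p) q) : r = 0 := by
  cases q with
  | zero =>
    exact toAbsolute_zero_injective R R (bandPiece P p) (by rw [toAbsolute_bandPiece_eq_zero R P hp hpS, map_zero])
  | succ q =>
    obtain ⟨a, rfl⟩ := δ_bandPiece_surjective R P hp hpS q r
    obtain ⟨x, rfl⟩ := (map_psi_bijective R P hp hpS q).2 a
    obtain ⟨y, rfl⟩ := ((P.isCupSphere_gen R).low (Fib P p) q (by omega)).2 x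
    rw [map_psi_map_fst R P hp, ← ModuleCat.comp_apply, map_subsetIncl_comp_δ]
    rfl

/-- The inclusion of `E₊` maps the band piece into `E₋`. [folklore] -/
theorem mapsTo_subsetIncl_plusSet : MapsTo (subsetIncl (plusSet P p)) (bandPiece P p) (minusSet P p) :=
  fun _ he => he

/-- **The excision map `Hⁿ(E, E₋) → Hⁿ(E₊, band piece)`.** [cite: HatcherAT2002, §3.1 p. 201] -/
abbrev exc (n : ℕ) : relSingularCohomology R R E (minusSet P p) n ⟶ relSingularCohomology R R ↥(plusSet P p) (bandPiece P p) n :=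
  relSingularCohomology.map R R (subsetIncl (plusSet P p)) (mapsTo_subsetIncl_plusSet P) n

/-- **Excision** (the interiors of the open pieces `E₊`, `E₋` cover). [cite: HatcherAT2002, §3.1 p. 201] -/
theorem isIso_exc (hpc : Continuous p) (n : ℕ) : IsIso (exc R P (p := p) n) := by
  have h1 : IsOpen (minusSet P p) := isOpen_compl_singleton.preimage hpc
  have h2 : IsOpen (plusSet P p) := isOpen_compl_singleton.preimage hpc
  have hcov : interior (minusSet P p) ∪ interior (plusSet P p) = univ := by
    rw [h1.interior_eq, h2.interior_eq]
    ext e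
    simp only [mem_union, mem_preimage, mem_compl_iff, mem_singleton_iff, mem_univ, iff_true]
    by_contra h
    push Not at h
    exact P.v_ne_w (h.1.symm.trans h.2)
  exact relSingularCohomology.isIso_map_subsetIncl_of_interior R R (minusSet P p) (plusSet P p) hcov n

/-- `exc` is injective. [folklore] -/
theorem exc_injective (hpc : Continuous p) (n : ℕ) : Injective (exc R P (p := p) n) := by
  haveI := isIso_exc R P hpc n
  exact (asIso (exc R P (p := p) n)).toLinearEquiv.injective

/-- **Naturality of the connecting maps**: `exc (δ₁ z) = δ₂ (z|_{band piece})`. [cite: HatcherAT2002, §3.1 p. 200] -/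
theorem exc_δ (i : ℕ) (z : singularCohomology R R ↥(minusSet P p) i) :
    exc R P (i + 1) (relSingularCohomology.δ R R E (minusSet P p) i (i + 1) rfl z) =
      relSingularCohomology.δ R R ↥(plusSet P p) (bandPiece P p) i (i + 1) rfl
        (singularCohomology.map R R (bandToMinus P p) i z) := by
  rw [← ModuleCat.comp_apply, relSingularCohomology.δ_comp_map (subsetIncl (plusSet P p)) (mapsTo_subsetIncl_plusSet P)
    i (i + 1) rfl, ModuleCat.comp_apply]
  rfl

/-- **The connecting map of `(E, E₋)` is `λ' ∘ D ∘ ψ`** in degrees `i + (k+1)`. [cite: Whitehead1978, Ch. VII §7, Thm. 7.14] -/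
theorem exc_δ_eq_lamRel (hp : IsHurewiczFibration.{0, 0, 0} p) (hpS : IsSerreFibration p) (i : ℕ) (z : singularCohomology R R ↥(minusSet P p) (i + (k + 1))) :
    exc R P (i + (k + 1) + 1) (relSingularCohomology.δ R R E (minusSet P p) (i + (k + 1)) (i + (k + 1) + 1) rfl z) =
      lamRel R P hp i (D R P hp hpS i (psiH R P hp hpS (i + (k + 1)) z)) := by
  rw [exc_δ, ← map_psi_T_psiH R P hp hpS, T_eq_sphereSplit, δ_map_psi_sphereSplit]

/-- Below degree `k + 1` the connecting map of `(E, E₋)` vanishes. [cite: Whitehead1978, Ch. VII §7] -/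
theorem δ_eq_zero_of_lt (hp : IsHurewiczFibration.{0, 0, 0} p) (hpS : IsSerreFibration p) {q : ℕ} (hq : q < k + 1) (z : singularCohomology R R ↥(minusSet P p) q) :
    relSingularCohomology.δ R R E (minusSet P p) q (q + 1) rfl z = 0 := by
  apply exc_injective R P hp.continuous
  rw [map_zero, exc_δ, ← map_psi_T_psiH R P hp hpS, T_eq_map_fst_of_lt R P hp hpS hq, map_psi_map_fst R P hp,
    ← ModuleCat.comp_apply, map_subsetIncl_comp_δ]
  rfl

end Pairs

/-! ### The Wang sequence -/

section Main


/-- **Exactness at `Hⁿ(F)`: the image of `ι^* : H^{i+(k+1)}(E) → H^{i+(k+1)}(F)` is `ker D`.**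
[cite: Whitehead1978, Ch. VII §7, Thm. 7.14] [cite: Serre1951, Ch. III §6] -/
theorem mem_range_iff_D_eq_zero (hp : IsHurewiczFibration.{0, 0, 0} p) (hpS : IsSerreFibration p) (i : ℕ) (y : singularCohomology R R (Fib P p) (i + (k + 1))) :
    (∃ x : singularCohomology R R E (i + (k + 1)), singularCohomology.map R R (fibIncl P p) (i + (k + 1)) x = y) ↔
      D R P hp hpS i y = 0 := by
  constructor
  · rintro ⟨x, rfl⟩
    rw [← psiH_map_subsetIncl R P hp hpS]
    apply (lamRel_bijective R P hp hpS i).1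
    rw [map_zero, ← exc_δ_eq_lamRel, ← ModuleCat.comp_apply (singularCohomology.map R R (subsetIncl (minusSet P p)) _),
      map_subsetIncl_comp_δ]
    change exc R P _ 0 = 0
    rw [map_zero]
  · intro hy
    set z := (psiH R P hp hpS (i + (k + 1))).symm y with hz
    have hyz : y = psiH R P hp hpS (i + (k + 1)) z := by rw [hz, LinearEquiv.apply_symm_apply]
    have hδ : relSingularCohomology.δ R R E (minusSet P p) (i + (k + 1)) (i + (k + 1) + 1) rfl z = 0 := by
      apply exc_injective R P hp.continuous
      rw [map_zero, exc_δ_eq_lamRel R P hp hpS, ← hyz, hy, map_zero]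
    have ex := relSingularCohomology.exact_map_δ (R := R) (M := R) (X := E) (minusSet P p) (i + (k + 1)) (i + (k + 1) + 1) rfl
    rw [ShortComplex.moduleCat_exact_iff] at ex
    obtain ⟨x, hx⟩ := ex z hδ
    refine ⟨x, ?_⟩
    rw [← psiH_map_subsetIncl R P hp hpS, hyz]
    exact congrArg _ hx

/-- **`ι^* : Hᵠ(E) → Hᵠ(F)` is injective for `q ≤ k + 1`** (`Hᵠ(E, E₋) ≅ Hᵠ(E₊, band) = 0`).
[cite: Whitehead1978, Ch. VII §7, Cor. 7.15] -/
theorem map_fibIncl_injective (hp : IsHurewiczFibration.{0, 0, 0} p) (hpS : IsSerreFibration p) {q : ℕ} (hq : q ≤ k + 1) : Injective (singularCohomology.map R R (fibIncl P p) q) := by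
  rw [injective_iff_map_eq_zero]
  intro x hx
  rw [← psiH_map_subsetIncl R P hp hpS, LinearEquiv.map_eq_zero_iff] at hx
  have ex := relSingularCohomology.exact_toAbsolute_map (R := R) (M := R) (X := E) (minusSet P p) q
  rw [ShortComplex.moduleCat_exact_iff] at ex
  obtain ⟨r, rfl⟩ := ex x hx
  have hr : exc R P q r = 0 := rel_eq_zero_of_le R P hp hpS hq _
  rw [(exc_injective R P hp.continuous q) (hr.trans (map_zero _).symm), map_zero]

/-- **`ι^* : Hᵠ(E) → Hᵠ(F)` is bijective for `q < k + 1`.** [cite: Whitehead1978, Ch. VII §7, Cor. 7.15] -/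
theorem map_fibIncl_bijective_of_lt (hp : IsHurewiczFibration.{0, 0, 0} p) (hpS : IsSerreFibration p) {q : ℕ} (hq : q < k + 1) : Bijective (singularCohomology.map R R (fibIncl P p) q) := by
  refine ⟨map_fibIncl_injective R P hp hpS hq.le, fun y => ?_⟩
  set z := (psiH R P hp hpS q).symm y with hz
  have hyz : y = psiH R P hp hpS q z := by rw [hz, LinearEquiv.apply_symm_apply]
  have ex := relSingularCohomology.exact_map_δ (R := R) (M := R) (X := E) (minusSet P p) q (q + 1) rfl
  rw [ShortComplex.moduleCat_exact_iff] at ex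
  obtain ⟨x, hx⟩ := ex z (δ_eq_zero_of_lt R P hp hpS hq z)
  refine ⟨x, ?_⟩
  rw [← psiH_map_subsetIncl R P hp hpS, hyz]
  exact congrArg _ hx

/-- **`λ : Hⁱ(F) → H^{i+k+2}(E)`**, `λ = j ∘ exc⁻¹ ∘ λ'` (the map `H^{q-m}(F) → Hᵠ(E)` of the Wang
sequence). [cite: Whitehead1978, Ch. VII §7, Thm. 7.14] -/
def lam (hp : IsHurewiczFibration.{0, 0, 0} p) (i : ℕ) : singularCohomology R R (Fib P p) i →ₗ[R] singularCohomology R R E (i + (k + 1) + 1) :=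
  haveI := isIso_exc R P hp.continuous (i + (k + 1) + 1)
  (relSingularCohomology.toAbsolute R R E (minusSet P p) (i + (k + 1) + 1)).hom ∘ₗ
    (inv (exc R P (p := p) (i + (k + 1) + 1))).hom ∘ₗ lamRel R P hp i

/-- `exc⁻¹ (exc r) = r`. [folklore] -/
theorem inv_exc_apply (hp : IsHurewiczFibration.{0, 0, 0} p) (n : ℕ) (r : relSingularCohomology R R E (minusSet P p) n) :
    haveI := isIso_exc R P hp.continuous n
    inv (exc R P (p := p) n) (exc R P n r) = r := by
  rw [← ModuleCat.comp_apply, IsIso.hom_inv_id]; rfl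

/-- `exc (exc⁻¹ r) = r`. [folklore] -/
theorem exc_inv_apply (hp : IsHurewiczFibration.{0, 0, 0} p) (n : ℕ) (r : relSingularCohomology R R ↥(plusSet P p) (bandPiece P p) n) :
    haveI := isIso_exc R P hp.continuous n
    exc R P n (inv (exc R P (p := p) n) r) = r := by
  rw [← ModuleCat.comp_apply, IsIso.inv_hom_id]; rfl

/-- **Exactness at `H^{q-m}(F)`: `λ b = 0 ↔ b ∈ range D`.** [cite: Whitehead1978, Ch. VII §7, Thm. 7.14] -/
theorem lam_eq_zero_iff (hp : IsHurewiczFibration.{0, 0, 0} p) (hpS : IsSerreFibration p) (i : ℕ) (b : singularCohomology R R (Fib P p) i) :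
    lam R P hp i b = 0 ↔ ∃ y, D R P hp hpS i y = b := by
  haveI := isIso_exc R P hp.continuous (i + (k + 1) + 1)
  have ex := relSingularCohomology.exact_δ_toAbsolute (R := R) (M := R) (X := E) (minusSet P p) (i + (k + 1)) (i + (k + 1) + 1) rfl
  rw [ShortComplex.moduleCat_exact_iff] at ex
  constructor
  · intro h
    obtain ⟨z, hz⟩ := ex (inv (exc R P (p := p) (i + (k + 1) + 1)) (lamRel R P hp i b)) h
    refine ⟨psiH R P hp hpS _ z, (lamRel_bijective R P hp hpS i).1 ?_⟩
    rw [← exc_δ_eq_lamRel, show relSingularCohomology.δ R R E (minusSet P p) (i + (k + 1)) (i + (k + 1) + 1) rfl z = _ from hz,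
      exc_inv_apply R P hp]
  · rintro ⟨y, rfl⟩
    set z := (psiH R P hp hpS (i + (k + 1))).symm y with hz
    have hyz : y = psiH R P hp hpS (i + (k + 1)) z := by rw [hz, LinearEquiv.apply_symm_apply]
    have hkey : inv (exc R P (p := p) (i + (k + 1) + 1)) (lamRel R P hp i (D R P hp hpS i y)) =
        relSingularCohomology.δ R R E (minusSet P p) (i + (k + 1)) (i + (k + 1) + 1) rfl z := by
      apply exc_injective R P hp.continuous
      rw [exc_inv_apply R P hp, hyz, exc_δ_eq_lamRel]
    change relSingularCohomology.toAbsolute R R E (minusSet P p) _ (inv (exc R P (p := p) _) (lamRel R P hp i _)) = 0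
    rw [hkey, ← ModuleCat.comp_apply]
    exact congrFun (congrArg DFunLike.coe (congrArg ModuleCat.Hom.hom
      ((relShortComplex_shortExact R R (minusSet P p)).δ_comp (i + (k + 1)) (i + (k + 1) + 1) rfl))) z

/-- **Exactness at `Hⁿ(E)`: `x ∈ range λ ↔ ι^* x = 0`.** [cite: Whitehead1978, Ch. VII §7, Thm. 7.14] -/
theorem mem_range_lam_iff (hp : IsHurewiczFibration.{0, 0, 0} p) (hpS : IsSerreFibration p) (i : ℕ) (x : singularCohomology R R E (i + (k + 1) + 1)) :
    (∃ b, lam R P hp i b = x) ↔ singularCohomology.map R R (fibIncl P p) (i + (k + 1) + 1) x = 0 := by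
  haveI := isIso_exc R P hp.continuous (i + (k + 1) + 1)
  have ex := relSingularCohomology.exact_toAbsolute_map (R := R) (M := R) (X := E) (minusSet P p) (i + (k + 1) + 1)
  rw [ShortComplex.moduleCat_exact_iff] at ex
  rw [← psiH_map_subsetIncl R P hp hpS, LinearEquiv.map_eq_zero_iff]
  constructor
  · rintro ⟨b, rfl⟩
    change singularCohomology.map R R (subsetIncl (minusSet P p)) _
      (relSingularCohomology.toAbsolute R R E (minusSet P p) _ _) = 0
    rw [← ModuleCat.comp_apply, toAbsolute_comp_map_subsetIncl]; rfl
  · intro hx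
    obtain ⟨r, rfl⟩ := ex x hx
    obtain ⟨b, hb⟩ := (lamRel_bijective R P hp hpS i).2 (exc R P _ r)
    refine ⟨b, ?_⟩
    change relSingularCohomology.toAbsolute R R E (minusSet P p) _ (inv (exc R P (p := p) _) (lamRel R P hp i b)) = _
    rw [hb, inv_exc_apply R P hp]

end Main

end Wang

end Literature.AlgebraicTopology.Homotopy
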